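import Mathlib
import Summits.KontsevichZagierPeriods.KontsevichZagierPeriods.Theses.SymplecticScissors

/-!
# `DiscSectorOneLine` (stmt-KontsevichZagierPeriods-9855, route SymplecticScissors) — the calibration
move

The support item `DiscSectorOneLine` of route SymplecticScissors: the rational map
`Φ (x, y) = (y / x, x² / 2)` is ONE change-of-variables generator (`KZ.changeOfVariablesRel`,
rule (2) of [Kontsevich–Zagier 2001, §1.2]) carrying the disc sector
`σ = {0 < y < x, x² + y² < 1}` (area `π / 8`) with integrand `1` onto the subgraph
`{0 < s < 1, 0 < t < 1 / (2 (1 + s²))}` (area `∫₀¹ ds / (2 (1 + s²)) = π / 8`) with integrand `1`.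

The witness, checked against the five fields of `changeOfVariablesRel`:
* `Φ` is `ℚ`-semialgebraic on `σ` (coordinates `X₁ / X₀` with `X₀ ≠ 0` on `σ`, and `X₀² / 2`:
  `isSemialgebraicFunOn_aeval_div_aeval` + `IsSemialgebraicMapOn.of_forall`);
* `Φ` is differentiable at every point with `x ≠ 0`, with derivative
  `Φ' (x, y) = [[-y / x², 1 / x], [x, 0]]`, so `det Φ' = -1` and `|det Φ'| = 1`;
* `Φ` is injective on `{x > 0}` (`x = √(2t)`, `y = s x`);
* `Φ '' σ = {0 < s < 1, 0 < t < 1 / (2 (1 + s²))}`: `s = y / x ∈ (0, 1)`, `t = x² / 2 > 0` and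
  `x² (1 + s²) = x² + y² < 1`; conversely `(√(2t), s √(2t)) ∈ σ` maps to `(s, t)`;
* `1 = 1 · |−1|` on `σ`.

Sources: M. Kontsevich, D. Zagier, *Periods* (2001), §1.1 (the `π` example), §1.2 rule (2);
everything else is calculus bookkeeping (folklore).
-/

noncomputable section

open Set MeasureTheory MvPolynomial
open Literature.NumberTheory.Transcendental

namespace Summit.KontsevichZagierPeriods.SymplecticScissors.DiscSectorOneLine

open Summit.KontsevichZagierPeriods.KontsevichZagierPeriods.Theses.SymplecticScissors (DiscSectorOneLine)

/-- The derivative of the first coordinate `p ↦ p 1 / p 0` of the calibration map at a point with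
`p 0 ≠ 0` is `v ↦ (p 0)⁻¹ v 1 - (p 1 / p 0 ^ 2) v 0`. [folklore] -/
theorem hasFDerivAt_discSector_fst (x : Fin 2 → ℝ) (hx : x 0 ≠ 0) :
    HasFDerivAt (fun p : Fin 2 → ℝ => p 1 / p 0)
      ((x 0)⁻¹ • ContinuousLinearMap.proj (R := ℝ) (φ := fun _ : Fin 2 => ℝ) 1 -
        (x 1 / x 0 ^ 2) • ContinuousLinearMap.proj (R := ℝ) (φ := fun _ : Fin 2 => ℝ) 0) x := by
  have h1 : HasFDerivAt (fun p : Fin 2 → ℝ => p 1)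
      (ContinuousLinearMap.proj (R := ℝ) (φ := fun _ : Fin 2 => ℝ) 1) x := hasFDerivAt_apply 1 x
  have h0 : HasFDerivAt (fun p : Fin 2 → ℝ => p 0)
      (ContinuousLinearMap.proj (R := ℝ) (φ := fun _ : Fin 2 => ℝ) 0) x := hasFDerivAt_apply 0 x
  have hinv : HasFDerivAt (fun p : Fin 2 → ℝ => (p 0)⁻¹)
      ((-(x 0 ^ 2)⁻¹) • ContinuousLinearMap.proj (R := ℝ) (φ := fun _ : Fin 2 => ℝ) 0) x :=
    (hasDerivAt_inv hx).comp_hasFDerivAt x h0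
  have hmul := h1.mul hinv
  have hfun : (fun p : Fin 2 → ℝ => p 1 / p 0) =
      (fun p : Fin 2 → ℝ => p 1) * fun p : Fin 2 → ℝ => (p 0)⁻¹ := by
    funext p
    simp [div_eq_mul_inv]
  rw [hfun]
  refine hmul.congr_fderiv ?_
  ext v
  simp only [_root_.add_apply, _root_.smul_apply, _root_.sub_apply,
    ContinuousLinearMap.proj_apply, smul_eq_mul]
  field_simp
  ring

/-- The derivative of the second coordinate `p ↦ p 0 ^ 2 / 2` of the calibration map is
`v ↦ p 0 · v 0`. [folklore] -/
theorem hasFDerivAt_discSector_snd (x : Fin 2 → ℝ) :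
    HasFDerivAt (fun p : Fin 2 → ℝ => p 0 ^ 2 / 2)
      (x 0 • ContinuousLinearMap.proj (R := ℝ) (φ := fun _ : Fin 2 => ℝ) 0) x := by
  have h0 : HasFDerivAt (fun p : Fin 2 → ℝ => p 0)
      (ContinuousLinearMap.proj (R := ℝ) (φ := fun _ : Fin 2 => ℝ) 0) x := hasFDerivAt_apply 0 x
  have h := ((hasDerivAt_pow 2 (x 0)).div_const 2).comp_hasFDerivAt x h0
  refine h.congr_fderiv ?_
  ext v
  simp only [_root_.smul_apply, ContinuousLinearMap.proj_apply, smul_eq_mul]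
  push_cast
  ring

/-- **The calibration move** (support `DiscSectorOneLine`, stmt-KontsevichZagierPeriods-9855).
For representations `r` on the disc sector `{0 < p 1 < p 0, p 0 ^ 2 + p 1 ^ 2 < 1}` and `r'` on
`{0 < q 0 < 1, 0 < q 1 < 1 / (2 (1 + q 0 ^ 2))}`, both with integrand `1` on their domains,
`[r] − [r']` is one change-of-variables generator of the Kontsevich–Zagier calculus, with witness
`Φ p = (p 1 / p 0, p 0 ^ 2 / 2)` and `Φ' p = [[-p 1 / p 0 ², 1 / p 0], [p 0, 0]]` (`|det| = 1`).
[Kontsevich–Zagier 2001, §1.2, rule (2)] -/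
theorem DiscSectorOneLine_proof : DiscSectorOneLine := by
  intro r r' hr hr' hf hf'
  -- membership in the two domains, unfolded
  have memr : ∀ p, p ∈ r.domain ↔ (0 < p 1 ∧ p 1 < p 0 ∧ p 0 ^ 2 + p 1 ^ 2 < 1) := fun p => by
    rw [hr]; rfl
  have memr' : ∀ q, q ∈ r'.domain ↔
      (0 < q 0 ∧ q 0 < 1 ∧ 0 < q 1 ∧ q 1 < 1 / (2 * (1 + q 0 ^ 2))) := fun q => by
    rw [hr']; rfl
  -- the witness
  let Φ : (Fin 2 → ℝ) → (Fin 2 → ℝ) := fun p => ![p 1 / p 0, p 0 ^ 2 / 2]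
  let Φ' : (Fin 2 → ℝ) → (Fin 2 → ℝ) →L[ℝ] (Fin 2 → ℝ) := fun x =>
    ContinuousLinearMap.pi
      ![(x 0)⁻¹ • ContinuousLinearMap.proj (R := ℝ) (φ := fun _ : Fin 2 => ℝ) 1 -
          (x 1 / x 0 ^ 2) • ContinuousLinearMap.proj (R := ℝ) (φ := fun _ : Fin 2 => ℝ) 0,
        x 0 • ContinuousLinearMap.proj (R := ℝ) (φ := fun _ : Fin 2 => ℝ) 0]
  have hΦ0 : ∀ p, Φ p 0 = p 1 / p 0 := fun p => rfl
  have hΦ1 : ∀ p, Φ p 1 = p 0 ^ 2 / 2 := fun p => rfl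
  -- the Jacobian determinant
  have hdet : ∀ x : Fin 2 → ℝ, x 0 ≠ 0 → (Φ' x).det = -1 := by
    intro x hx0
    simp only [ContinuousLinearMap.det]
    rw [← LinearMap.det_toMatrix', Matrix.det_fin_two]
    simp [Φ', LinearMap.toMatrix'_apply, hx0]
  -- Φ maps the sector into the subgraph
  have hmaps : ∀ p ∈ r.domain, Φ p ∈ r'.domain := by
    intro p hp
    obtain ⟨hp1, hp10, hpr⟩ := (memr p).1 hp
    have hp0 : 0 < p 0 := hp1.trans hp10
    rw [memr', hΦ0, hΦ1]
    refine ⟨div_pos hp1 hp0, (div_lt_one hp0).2 hp10, by positivity, ?_⟩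
    rw [lt_div_iff₀ (by positivity)]
    have : p 0 ^ 2 / 2 * (2 * (1 + (p 1 / p 0) ^ 2)) = p 0 ^ 2 + p 1 ^ 2 := by
      field_simp
    rw [this]
    exact hpr
  -- Φ is onto the subgraph: explicit inverse `(√(2t), s √(2t))`
  have hsurj : ∀ q ∈ r'.domain, ∃ p ∈ r.domain, Φ p = q := by
    intro q hq
    obtain ⟨hq0, hq01, hq1, hq1'⟩ := (memr' q).1 hq
    set s : ℝ := Real.sqrt (2 * q 1) with hs_def
    have hs : 0 < s := Real.sqrt_pos.2 (by positivity)
    have hs2 : s ^ 2 = 2 * q 1 := Real.sq_sqrt (by positivity)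
    refine ⟨![s, q 0 * s], ?_, ?_⟩
    · rw [memr]
      simp only [Matrix.cons_val_zero, Matrix.cons_val_one]
      refine ⟨by positivity, ?_, ?_⟩
      · calc q 0 * s < 1 * s := mul_lt_mul_of_pos_right hq01 hs
          _ = s := one_mul s
      · have h2 : q 1 * (2 * (1 + q 0 ^ 2)) < 1 := by
          rwa [lt_div_iff₀ (by positivity)] at hq1'
        nlinarith [hs2]
    · funext i
      refine Fin.cases ?_ (fun j => Fin.cases ?_ (fun k => k.elim0) j) i
      · show Φ ![s, q 0 * s] 0 = q 0
        rw [hΦ0]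
        simp only [Matrix.cons_val_zero, Matrix.cons_val_one]
        field_simp
      · show Φ ![s, q 0 * s] 1 = q 1
        rw [hΦ1]
        simp only [Matrix.cons_val_zero]
        rw [hs2]
        ring
  refine ⟨2, r, r', Φ, Φ', ?_, ?_, ?_, ?_, ?_, rfl⟩
  · -- `Φ` is `ℚ`-semialgebraic on the sector
    refine IsSemialgebraicMapOn.of_forall r.isSemialgebraic_domain (Fin.forall_fin_two.2 ⟨?_, ?_⟩)
    · have hq : ∀ p ∈ r.domain, aeval p (X 0 : MvPolynomial (Fin 2) ℚ) ≠ (0 : ℝ) := by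
        intro p hp
        obtain ⟨hp1, hp10, -⟩ := (memr p).1 hp
        rw [aeval_X]
        exact (hp1.trans hp10).ne'
      refine (isSemialgebraicFunOn_aeval_div_aeval r.isSemialgebraic_domain (X 1) (X 0) hq).congr ?_
      intro p _
      simp [hΦ0]
    · have hq : ∀ p ∈ r.domain, aeval p (2 : MvPolynomial (Fin 2) ℚ) ≠ (0 : ℝ) := by
        intro p _
        simp
      refine (isSemialgebraicFunOn_aeval_div_aeval r.isSemialgebraic_domain (X 0 ^ 2) 2 hq).congr ?_
      intro p _
      simp [hΦ1]
  · -- differentiability within the sector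
    intro x hx
    obtain ⟨hx1, hx10, -⟩ := (memr x).1 hx
    have hx0 : x 0 ≠ 0 := (hx1.trans hx10).ne'
    refine HasFDerivAt.hasFDerivWithinAt (hasFDerivAt_pi'' (Fin.forall_fin_two.2 ⟨?_, ?_⟩))
    · rw [ContinuousLinearMap.proj_pi]
      exact hasFDerivAt_discSector_fst x hx0
    · rw [ContinuousLinearMap.proj_pi]
      exact hasFDerivAt_discSector_snd x
  · -- injectivity on the sector
    intro p hp q hq hpq
    obtain ⟨hp1, hp10, -⟩ := (memr p).1 hp
    obtain ⟨hq1, hq10, -⟩ := (memr q).1 hq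
    have hp0 : 0 < p 0 := hp1.trans hp10
    have hq0 : 0 < q 0 := hq1.trans hq10
    have e0 : p 1 / p 0 = q 1 / q 0 := by rw [← hΦ0, ← hΦ0, hpq]
    have e1 : p 0 ^ 2 / 2 = q 0 ^ 2 / 2 := by rw [← hΦ1, ← hΦ1, hpq]
    have h0 : p 0 = q 0 := by
      have h : p 0 ^ 2 = q 0 ^ 2 := by linarith
      exact (pow_left_inj₀ hp0.le hq0.le two_ne_zero).1 h
    have h1 : p 1 = q 1 := by
      rw [h0] at e0
      field_simp at e0
      exact e0
    exact funext (Fin.forall_fin_two.2 ⟨h0, h1⟩)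
  · -- the image is the subgraph
    refine Subset.antisymm (fun q hq => ?_) ?_
    · obtain ⟨p, hp, hpq⟩ := hsurj q hq
      exact ⟨p, hp, hpq⟩
    · rintro _ ⟨p, hp, rfl⟩
      exact hmaps p hp
  · -- the integrands: `1 = 1 · |−1|`
    intro x hx
    obtain ⟨hx1, hx10, -⟩ := (memr x).1 hx
    rw [hf x hx, hf' _ (hmaps x hx), hdet x (hx1.trans hx10).ne']
    norm_num

end Summit.KontsevichZagierPeriods.SymplecticScissors.DiscSectorOneLine
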